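import Mathlib
import Summits.NavierStokesRegularity.NavierStokesRegularity.Theorems.FilamentSkeletonRssStadiumFrozenSegmentNhds

/-!
# Route `FilamentSkeletonRss` · cruxes `SkeletonJ1L` (stmt-NavierStokesRegularity-23296, registered stub `stub_tangentSkeletonL` ≡
# `TangentSkeletonNearStraightL`, stmt-23320) · line `child_tangent_analytic_strip_L` (b0b56c52900dd90a), stub `stub_stripPropagation` —
# brick for the freeze step of `rcore`: THE FROZEN POLYGON OF THE ANCHOR'S TENT IS HOLOMORPHIC AND BOUNDED NEAR THE ANCHOR

`Theorems.StadiumFrozenSegmentNhds.frozenSegment_nhds` handles ONE frozen complex segment (integrand written with the direction `q − p` inside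
the cross product, as a set integral over `[0,1]`); the tube shift / tent freeze (`Theorems.StadiumPolygonalTubeShift`,
`Theorems.StadiumTentFreeze`) write segment integrals as `∫₀¹ (q − p) • f(p + t(q − p)) dt` with the bare kernel
`f = ((Σᵢ (Fᵢ z − Fᵢ ζ)² + κ G ζ)^{3/2})⁻¹ • (F′ ζ ⨯₃ (F z − F ζ))`.  Here:
* `segment_forms_eq` — the two normal forms of a segment piece agree (bilinearity of `⨯₃`, `[0,1]` vs `0..1`);
* `frozenPolygon_nhds` — for a polygon `P 0 → ⋯ → P n` inside the stadium with POINTWISE POSITIVITY AT THE ANCHOR along every segment, there is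
  `δ > 0` with `B(z₀, δ) ⊆ S` on which the frozen polygon integral `z ↦ Σ_{k<n} [P k, P (k+1)]_{f_z}` is holomorphic and bounded by an
  explicit-free constant (induction over the segments, minimum of the radii).
So the complex part of the frozen tent needs only the positivity-form corner certificates at the anchor.
HONEST FRAMING: a brick for the bookkeeping of a HYPOTHETICAL filament skeleton on the NEGATIVE side of a MODEL route; the stub `stub_stripPropagation`
is NOT closed by this file, `TangentSkeletonNearStraightL` / `SkeletonJ1L` stay OPEN; nothing here bears on Navier–Stokes regularity or blow-up.
`--supports stmt-NavierStokesRegularity-23320` (≡ stub `stub_tangentSkeletonL` of 23296).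
-/

set_option linter.dupNamespace false

noncomputable section

namespace Summit.NavierStokesRegularity.NavierStokesRegularity.Theorems.StadiumFrozenPolygon

open Set Filter Topology Complex MeasureTheory Metric Finset
open scoped Matrix
open Summit.NavierStokesRegularity.NavierStokesRegularity.Theorems.StadiumFrozenSegmentNhds
open Summit.NavierStokesRegularity.NavierStokesRegularity.Theorems.StadiumPartnerPiece

/-- The two normal forms of a frozen segment piece agree: `∫₀¹ (q − p) • (k • (D ⨯₃ v)) = ∫_{[0,1]} k • (((q − p) • D) ⨯₃ v)`. [folklore] -/
theorem segment_forms_eq (F : ℂ → (Fin 3 → ℂ)) (G : ℂ → ℂ) (κ : ℝ) (z p q : ℂ) :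
    (∫ t in (0:ℝ)..1, (q - p) •
        ((((∑ i, (F z i - F (p + (t : ℂ) * (q - p)) i) ^ 2) + (κ : ℂ) * G (p + (t : ℂ) * (q - p))) ^ ((3:ℂ) / 2))⁻¹ •
          (deriv F (p + (t : ℂ) * (q - p)) ⨯₃ (fun i => F z i - F (p + (t : ℂ) * (q - p)) i)))) =
      ∫ t in Icc (0:ℝ) 1,
        (((∑ i, (F z i - F (p + (t : ℂ) * (q - p)) i) ^ 2) + (κ : ℂ) * G (p + (t : ℂ) * (q - p))) ^ ((3:ℂ) / 2))⁻¹ •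
          (((q - p) • deriv F (p + (t : ℂ) * (q - p))) ⨯₃ (fun i => F z i - F (p + (t : ℂ) * (q - p)) i)) := by
  rw [intervalIntegral.integral_of_le zero_le_one, integral_Icc_eq_integral_Ioc]
  refine setIntegral_congr_fun measurableSet_Ioc fun t _ => ?_
  simp only [map_smul, LinearMap.smul_apply]
  rw [smul_comm]

/-- **The frozen polygon near the anchor.**  Stadium `S = {|Im| < hs, |Re − cc| < L + hs}`, `F` holomorphic on `S` with `‖F′‖ ≤ M`, `G`
continuous on `S`, anchor `z₀ ∈ S`; a polygon `P 0 → ⋯ → P n` whose segments lie in `S`, with pointwise positivity at the anchor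
`0 < Re(Σᵢ (Fᵢ z₀ − Fᵢ ζ)² + κ G ζ)` along every segment.  Then for some `δ > 0` with `B(z₀, δ) ⊆ S` and some constant `C`, the frozen polygon
integral `z ↦ Σ_{k<n} ∫₀¹ (P (k+1) − P k) • f_z(P k + t(P (k+1) − P k)) dt` is holomorphic on `B(z₀, δ)` and bounded there by `C`. [folklore] -/
theorem frozenPolygon_nhds {hs L cc M : ℝ} {F : ℂ → (Fin 3 → ℂ)}
    (hF : DifferentiableOn ℂ F {z : ℂ | |z.im| < hs ∧ |z.re - cc| < L + hs})
    (hM : ∀ z ∈ {z : ℂ | |z.im| < hs ∧ |z.re - cc| < L + hs}, ‖deriv F z‖ ≤ M) (hM0 : 0 ≤ M)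
    {G : ℂ → ℂ} (hG : ContinuousOn G {z : ℂ | |z.im| < hs ∧ |z.re - cc| < L + hs})
    {z₀ : ℂ} (hz₀ : z₀ ∈ {z : ℂ | |z.im| < hs ∧ |z.re - cc| < L + hs}) {κ : ℝ} (P : ℕ → ℂ) :
    ∀ n : ℕ,
      (∀ k < n, ∀ t ∈ Icc (0:ℝ) 1, P k + (t : ℂ) * (P (k+1) - P k) ∈ {z : ℂ | |z.im| < hs ∧ |z.re - cc| < L + hs}) →
      (∀ k < n, ∀ t ∈ Icc (0:ℝ) 1,
        0 < ((∑ i, (F z₀ i - F (P k + (t : ℂ) * (P (k+1) - P k)) i) ^ 2) +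
          (κ : ℂ) * G (P k + (t : ℂ) * (P (k+1) - P k))).re) →
      ∃ δ C : ℝ, 0 < δ ∧ ball z₀ δ ⊆ {z : ℂ | |z.im| < hs ∧ |z.re - cc| < L + hs} ∧
        DifferentiableOn ℂ (fun z => ∑ k ∈ range n, ∫ t in (0:ℝ)..1, (P (k+1) - P k) •
          ((((∑ i, (F z i - F (P k + (t : ℂ) * (P (k+1) - P k)) i) ^ 2) +
              (κ : ℂ) * G (P k + (t : ℂ) * (P (k+1) - P k))) ^ ((3:ℂ) / 2))⁻¹ •
            (deriv F (P k + (t : ℂ) * (P (k+1) - P k)) ⨯₃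
              (fun i => F z i - F (P k + (t : ℂ) * (P (k+1) - P k)) i)))) (ball z₀ δ) ∧
        ∀ z ∈ ball z₀ δ, ‖∑ k ∈ range n, ∫ t in (0:ℝ)..1, (P (k+1) - P k) •
          ((((∑ i, (F z i - F (P k + (t : ℂ) * (P (k+1) - P k)) i) ^ 2) +
              (κ : ℂ) * G (P k + (t : ℂ) * (P (k+1) - P k))) ^ ((3:ℂ) / 2))⁻¹ •
            (deriv F (P k + (t : ℂ) * (P (k+1) - P k)) ⨯₃
              (fun i => F z i - F (P k + (t : ℂ) * (P (k+1) - P k)) i)))‖ ≤ C := by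
  set S : Set ℂ := {z : ℂ | |z.im| < hs ∧ |z.re - cc| < L + hs} with hS
  intro n
  induction n with
  | zero =>
    intro _ _
    obtain ⟨ε, hε, hεS⟩ := Metric.isOpen_iff.mp (isOpen_stadium hs (L + hs) cc) z₀ hz₀
    exact ⟨ε, 0, hε, hεS, by simp, fun z _ => by simp⟩
  | succ n ih =>
    intro hseg hpos
    obtain ⟨δ₁, C₁, hδ₁, hball₁, hdiff₁, hbd₁⟩ :=
      ih (fun k hk => hseg k (Nat.lt_succ_of_lt hk)) (fun k hk => hpos k (Nat.lt_succ_of_lt hk))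
    -- the new segment `[P n, P (n+1)]`
    obtain ⟨μ, δ₂, hμ, hδ₂, hball₂, -, hdiff₂, hbd₂⟩ :=
      frozenSegment_nhds hF hM hM0 hG hz₀ (hseg n (Nat.lt_succ_self n)) (hpos n (Nat.lt_succ_self n))
    set δ : ℝ := min δ₁ δ₂ with hδ
    have hδpos : 0 < δ := lt_min hδ₁ hδ₂
    have hb1 : ball z₀ δ ⊆ ball z₀ δ₁ := ball_subset_ball (min_le_left _ _)
    have hb2 : ball z₀ δ ⊆ ball z₀ δ₂ := ball_subset_ball (min_le_right _ _)
    -- the new piece in the tube-shift normal form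
    have hdiff₂' : DifferentiableOn ℂ (fun z => ∫ t in (0:ℝ)..1, (P (n+1) - P n) •
        ((((∑ i, (F z i - F (P n + (t : ℂ) * (P (n+1) - P n)) i) ^ 2) +
            (κ : ℂ) * G (P n + (t : ℂ) * (P (n+1) - P n))) ^ ((3:ℂ) / 2))⁻¹ •
          (deriv F (P n + (t : ℂ) * (P (n+1) - P n)) ⨯₃
            (fun i => F z i - F (P n + (t : ℂ) * (P (n+1) - P n)) i)))) (ball z₀ δ₂) := by
      refine hdiff₂.congr fun z _ => ?_
      exact segment_forms_eq F G κ z (P n) (P (n+1))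
    refine ⟨δ, C₁ + μ ^ (-(3/2 : ℝ)) * (2 * (‖P (n+1) - P n‖ * M) * (M * (1 + (‖z₀ - P n‖ + ‖P (n+1) - P n‖)))),
      hδpos, hb1.trans hball₁, ?_, ?_⟩
    · simp_rw [Finset.sum_range_succ]
      exact (hdiff₁.mono hb1).add (hdiff₂'.mono hb2)
    · intro z hz
      rw [Finset.sum_range_succ]
      refine (norm_add_le _ _).trans (add_le_add (hbd₁ z (hb1 hz)) ?_)
      rw [segment_forms_eq F G κ z (P n) (P (n+1))]
      exact hbd₂ z (hb2 hz)

end Summit.NavierStokesRegularity.NavierStokesRegularity.Theorems.StadiumFrozenPolygon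

end
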